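import Literature.IUT.LogVolume.ExplicitEstimatesCorollary52Proof
import Literature.IUT.LogVolume.Corollary22CMLocus
import HarnessLib

/-!
# [ExpEst] Corollary 5.2, the `𝒦 = 𝒦_{𝕍(ℚ)^arc}(κ)` half — PROVED as an assembly from the same three named
# inputs (μ₆-[IUTchIII] Cor. 3.12 interface, Prop. 1.10, Prop. 2.2 (ii)); hence ALL of Corollary 5.2

S. Mochizuki, I. Fesenko, Y. Hoshi, A. Minamide, W. Porowski, *Explicit estimates in inter-universal
Teichmüller theory*, Kodai Math. J. **45** (2022) 175–236 — [ExpEst], bib key `MochizukiEtAl2022` (D-0012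
claim key, status disputed) — **Corollary 5.2**, statement pp. 210–212, proof pp. 212–218 (pdf pp. 36–44 of
the cell render `run/shared/lean/pub/abc-iut/plan/repair/lit/renders/MFHMP-ExplicitEstimates-Kodai2022-book-
anonnd-eeiutp`; locators `p<pdf>.l<line>`, journal page = pdf page + 174).

TAKES NO SIDE on [IUTchIII] Corollary 3.12 or on any author. PROOF-ONLY sequel of
`ExplicitEstimatesCorollary52Proof.lean` (mono-complex half, `ExpEst.partMcx_of_thm51LegendreMu6`): the
non-"respectively" clauses of Cor. 5.2 — the compactly bounded subset "`𝒦 := 𝒦_{𝕍(ℚ)^arc}(κ) ⊆ U_X(ℚ̄)`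
[cf. Definition 1.13]" (p. 211 = p37.l5–11), typed as `ExpEst.PartKappa κ d ε` (gen 0,
`ExplicitEstimatesCorollary52.lean`) — kernel-checked from EXACTLY the same three named inputs, each by name
and never asserted: `ExpEst.Thm51LegendreMu6` ((P7) + Theorem 5.1, the disputed chain; claim-tagged
HYPOTHESIS), `ExpEst.Prop110` ([ExpEst] Prop. 1.10 = Löbrich 2017, classical named fact; used in (P4) through
Cor. 1.14 **(ii)**), `Dusart2010_theta_thm_5_2` (Prop. 2.2 (ii); (P1)–(P3)).

The printed proof treats both halves in parallel ("(respectively, …)"); the `𝒦`-half differs from the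
mono-complex half at exactly two places, both kernel-checked here:
* (P4) (p. 215 = p41.l2–9): "the existence of an `l`-cyclic subgroup scheme of `E_F`, together with the fact
  that `l ≥ 10^15`, would imply that `h ≤ κ^log` [cf. (P2); Remark 1.10.1; Corollary 1.14, (ii)]" —
  `condP6_of_memKArc` below, from `ExpEst.exists_cor114Data` + `ExpEst.cor114_ii_le_kappaLog` (gen 4) with
  "`h_arc(j(E)) ≤ 11·log 2 − 3·log κ` on `𝒦_arc(κ)`" (Prop. 1.8 (ii) + Def. 1.13, `hArc_jInv_le_of_memKArc`)
  transported to the theta-field by Rmk. 1.7.1 (`hArc_algebraMap`, `hNon_algebraMap`), then (P6) by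
  `imageModLContainsSL2_of_condP5Mu6`;
* the exceptional set: "[by [15], Proposition 1.4, (iv) [cf. also the proof of [19], Corollary 2.2, (i)]] …
  there is only a finite number of possibilities for the `j`-invariant of `E_F`" (pp. 213, 215, 218) —
  `hasFinitelyManyPoints_kArc_logQForall_le` below: on `𝒦_arc(κ) ∩ U_X(ℚ̄)^{≤d}` a bound on `log(q^∀) =
  h_non(j(λ))` (Rmk. 1.10.1) bounds `h(j(λ))` (by `hArc_jInv_le_of_memKArc`), hence `h(λ)` (`2·h(λ) ≤ h(j(λ)) +
  10·log 2`, gen 4, NOT-IN-PRINT elementary step flagged there), hence Northcott (`northcott_UPle_holds`). The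
  points with `j ∈ {0, 1728}` ("contains all points corresponding to elliptic curves that admit
  automorphisms of order `> 2`", p. 211 = p37.l42–43) are adjoined as the finite CM locus
  (`Cor22.hasFinitelyManyPoints_jInv_cm_inter`; they need not lie in `𝒦_arc(κ)` for `κ > 1/2`, e.g. `λ = 2`).
All other steps are those of the mono-complex half verbatim (core-less `j`, (P1)–(P3), (P5), (P7), (P8),
Claims 5.2A/5.2B, (C2), (C1)), cited by name from the tree.

KERNEL READING (neutral): with `partMcx_of_thm51LegendreMu6`, the whole of [ExpEst] Corollary 5.2 as typed
(`PartKappa κ d ε ∧ PartMcx d ε` for `0 < κ ≤ 1`, `d ≥ 1`, `0 < ε ≤ 1`; `corollary52_of_thm51LegendreMu6`) is a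
consequence of {μ₆-[IUTchIII] Cor. 3.12 as applied on the Legendre family (`Thm51LegendreMu6`, DISPUTED
claim), Löbrich's Prop. 1.10 (classical fact), Dusart's `θ`-bound (classical fact)} and nothing else. A
conditional theorem discharges nothing it binds; typed ≠ proved ≠ endorsed; no abc / Szpiro assertion is
made. Proof-only file: theorems only, no definitions, no instances, no named facts.
-/

noncomputable section

open scoped Classical

namespace Literature.IUT.LogVolume
namespace ExpEst

open NumberField IsDedekindDomain Real Cor22 Literature.NumberTheory.DiophantineGeometry.GenEll
open Literature.NumberTheory.EllipticCurves
open Literature.NumberTheory.LFunctions (Dusart2010_theta_thm_5_2)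

/-! ## 1. The exceptional set on `𝒦_arc(κ)`: Northcott through `h_arc(j) ≤ 11·log 2 − 3·log κ` -/

/-- **"there is only a finite number of possibilities for the `j`-invariant of `E_F`. Thus, by possibly enlarging
the finite set `𝔈𝔵𝔠_{κ,d,ε}` …"** (proof of Cor. 5.2, pp. 213, 215, 218, the `𝒦`-half, "by [15], Proposition 1.4,
(iv)"), in the form `ExpEst.PartKappa` consumes: for `κ > 0`, every `d` and `B`, the minimally presented points
`λ ∈ U_X(ℚ̄)^{≤d} ∩ 𝒦_arc(κ)` with `log(q^∀(λ)) ≤ B` are finitely many (`GenEll.HasFinitelyManyPoints`). PROVED: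
`log(q^∀) = h_non(j(λ))` (Rmk. 1.10.1, `logQForall_eq_hNon`), `h_arc(j(λ)) ≤ 11·log 2 − 3·log κ` on `𝒦_arc(κ)`
(`hArc_jInv_le_of_memKArc`), `2·h(λ) ≤ h(j(λ)) + 10·log 2` (`two_mul_height_le_height_jInv`), Northcott on
`U_X(ℚ̄)^{≤d}` (`northcott_UPle_holds`). [cite: MochizukiEtAl2022, Cor 5.2 proof p. 213] -/
theorem hasFinitelyManyPoints_kArc_logQForall_le {κ : ℝ} (hκ : 0 < κ) (d : ℕ) (B : ℝ) :
    HasFinitelyManyPoints {P | P ∈ UPle d ∧ MemKArc κ P ∧ logQForall P ≤ B} := by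
  refine (northcott_UPle_holds d ((B + 11 * Real.log 2 - 3 * Real.log κ + 10 * Real.log 2) / 2)).mono ?_
  rintro P ⟨hPd, hK, hB⟩
  refine ⟨hPd, ?_⟩
  have hU : P.InU := hPd.1.1
  rw [ht_eq_height]
  have h1 : hNon (jInv P.x) ≤ B := by rw [← logQForall_eq_hNon]; exact hB
  have h2 := hArc_jInv_le_of_memKArc hκ P hU hK
  have h3 := two_mul_height_le_height_jInv P.x hU.1 hU.2
  have h4 : height (jInv P.x) = hNon (jInv P.x) + hArc (jInv P.x) := rfl
  linarith

/-! ## 2. (P4) ⟹ (P6) on `𝒦_arc(κ)`: Cor. 1.14 (ii) -/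

/-- **(P4) and (P6), the `𝒦`-half** (p. 214–216 = p40.l30 – p42.l4: "(P4) `E_F` does not admit an `l`-cyclic
subgroup scheme … the existence of an `l`-cyclic subgroup scheme of `E_F`, together with the fact that `l ≥
10^15`, would imply that `h ≤ κ^log` [cf. (P2); Remark 1.10.1; Corollary 1.14, (ii)] … (P6) follows formally from
(P2), (P4), and [15], Lemma 3.1, (iii)"): for `λ ∈ U_X(F_tpd) ∩ 𝒦_arc(κ)` (`0 < κ ≤ 1`), a prime `l ≥ 10^15` with (P2),
(P5), and `log(q^∀(λ)) > κ^log`, condition (P6) holds — for every theta-field `F ⊇ F_tpd` an `l`-cyclic subgroup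
scheme of `E_F` is excluded by Prop. 1.10 (`h110`) via Cor. 1.14 (ii) (`exists_cor114Data`, `cor114_ii_le_kappaLog`)
with `h_arc(j(E_F)) = h_arc(j(λ)) ≤ 11·log 2 − 3·log κ` (Rmk. 1.7.1 `hArc_algebraMap`; `hArc_jInv_le_of_memKArc`),
`h_non(j(E_F)) = log(q^∀(λ))` (`hNon_algebraMap`, `logQForall_eq_hNon`), "`l` prime to the local heights" from (P2)
(`Cor22.not_dvd_localHeight_of_condP2`); then `imageModLContainsSL2_of_condP5Mu6`. PROVED modulo `Prop110`.
[cite: MochizukiEtAl2022, Cor 5.2 proof (P4)–(P6) p. 214–216] -/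
theorem condP6_of_memKArc (h110 : Prop110) {κ : ℝ} (hκ0 : 0 < κ) (hκ1 : κ ≤ 1) {P : NFPoint}
    (hK : MemKArc κ P) {l : ℕ} (hl : l.Prime) (hl15 : 10 ^ 15 ≤ l) (hP2 : CondP2 P l)
    (hP5 : CondP5Mu6 P l) (hbig : kappaLog κ < logQForall P) : CondP6 P l := by
  intro hU F _ _ _ hF _
  letI iA : Algebra P.F (thetaEllPoint P hU F).F := ‹Algebra P.F F›
  haveI iG : IsGalois P.F (thetaEllPoint P hU F).F := hF.isGalois
  haveI : Fact l.Prime := ⟨hl⟩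
  have hdeg : Module.finrank P.F (thetaEllPoint P hU F).F ∣ 46080 := hF.finrank_dvd
  have hjQ : (thetaEllPoint P hU F).W.j = algebraMap P.F (thetaEllPoint P hU F).F (jInv P.x) :=
    thetaCurve_j F hU
  have hss : (thetaEllPoint P hU F).IsSemistable := hF.isSemistable
  have h7 : 7 ≤ l := le_trans (by norm_num) hl15
  have hl15r : (10 : ℝ) ^ 15 ≤ l := by exact_mod_cast hl15
  refine imageModLContainsSL2_of_condP5Mu6 (thetaEllPoint P hU F) hjQ hdeg hss h7 hP2 hP5 fun hcyc => ?_
  -- (P4): an `l`-cyclic subgroup scheme would force `log(q^∀(λ)) = h_non(j(E_F)) ≤ κ^log`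
  have hcop : ∀ w : HeightOneSpectrum (𝓞 (thetaEllPoint P hU F).F),
      (thetaEllPoint P hU F).W.HasMultiplicativeReductionAt w →
        ¬ ((l : ℤ) ∣ (thetaEllPoint P hU F).localHeight w) :=
    fun w hw => not_dvd_localHeight_of_condP2 (thetaEllPoint P hU F) hjQ hdeg hl h7 hP2 w hw
  obtain ⟨D, -⟩ := exists_cor114Data h110 (thetaEllPoint P hU F) hss hl hcyc hcop
  have harc : hArc (thetaEllPoint P hU F).W.j ≤ 11 * Real.log 2 - 3 * Real.log κ := by
    rw [hjQ, hArc_algebraMap]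
    exact hArc_jInv_le_of_memKArc hκ0 P hU hK
  have hle := cor114_ii_le_kappaLog D (hNon_nonneg _) hl15r hκ0 hκ1 harc
  rw [hjQ, hNon_algebraMap, ← logQForall_eq_hNon] at hle
  linarith

/-! ## 3. Corollary 5.2, the `𝒦_arc(κ)` half, assembled (pp. 212–218) -/

/-- **[ExpEst] Corollary 5.2, the `𝒦 = 𝒦_{𝕍(ℚ)^arc}(κ)` version, PROVED from the three named inputs** (statement
pp. 210–212 as typed in `ExpEst.PartKappa κ d ε`; proof pp. 212–218): for `0 < κ ≤ 1`, `d ≥ 1`, `0 < ε ≤ 1`, with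
`𝔈𝔵𝔠_{κ,d,ε} := {λ ∈ U_X(ℚ̄)^{≤d} ∩ 𝒦 : log(q^∀(λ)) ≤ max{κ^log, h_d(ε)}} ∪ {λ ∈ U_X(ℚ̄)^{≤d} : j(λ) ∈ {0, 1728}}`
(finite), every `λ ∈ U_X(ℚ̄)^{≤d} ∩ 𝒦` off it admits a prime `l` with (C1), (C2). Steps as in
`partMcx_of_thm51LegendreMu6`, except (P4) ⟹ (P6) by `condP6_of_memKArc` (`h > κ^log`). The disputed Theorem
5.1 enters only through `h51`; Prop. 1.10 only through `h110`; Dusart's bound only through `hD`.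
[claim: MochizukiEtAl2022, status: disputed] -/
theorem partKappa_of_thm51LegendreMu6 (h51 : Thm51LegendreMu6) (h110 : Prop110)
    (hD : Dusart2010_theta_thm_5_2) {κ : ℝ} (hκ0 : 0 < κ) (hκ1 : κ ≤ 1) {d : ℕ} (hd1 : 1 ≤ d) {ε : ℝ}
    (hε0 : 0 < ε) (hε1 : ε ≤ 1) : PartKappa κ d ε := by
  classical
  have hdr : (1 : ℝ) ≤ d := by exact_mod_cast hd1
  have hHd : (10 : ℝ) ^ 30 * (d : ℝ) ^ 2 ≤ hd d ε := hd_ge hd1 hε0 hε1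
  have hHd30 : (10 : ℝ) ^ 30 ≤ hd d ε := le_trans (by nlinarith) hHd
  set M : ℝ := max (kappaLog κ) (hd d ε) with hMdef
  have hMhd : hd d ε ≤ M := le_max_right _ _
  have hMκ : kappaLog κ ≤ M := le_max_left _ _
  refine ⟨{P | P ∈ UPle d ∧ MemKArc κ P ∧ logQForall P ≤ M} ∪
      {P | P ∈ UPle d ∧ (jInv P.x = 0 ∨ jInv P.x = 1728)},
    (hasFinitelyManyPoints_kArc_logQForall_le hκ0 d M).union (hasFinitelyManyPoints_jInv_cm_inter (UPle d)),
    ?_, ?_, ?_, ?_⟩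
  · rintro P (⟨hPd, -, -⟩ | ⟨hPd, -⟩) <;> exact hPd
  · intro P hPd hj; exact Or.inr ⟨hPd, hj⟩
  · rintro P (⟨-, -, hle⟩ | ⟨-, hj⟩)
    · exact hle
    · rw [logQForall_eq_zero_of_jInv_zero_or_1728 hj]; linarith
  -- the main case: `λ ∈ U_X(ℚ̄)^{≤d} ∩ 𝒦`, `λ ∉ 𝔈𝔵𝔠_{κ,d,ε}`
  intro P hPd hK hPexc
  have hPU : P ∈ UP := hPd.1
  have hPdeg : P.degree ≤ d := hPd.2
  have hU : P.InU := hPU.1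
  set h : ℝ := logQForall P with hhdef
  have hgtM : M < h := by by_contra hle; exact hPexc (Or.inl ⟨hPd, hK, not_lt.mp hle⟩)
  have hgt : hd d ε < h := lt_of_le_of_lt hMhd hgtM
  have hgtκ : kappaLog κ < h := lt_of_le_of_lt hMκ hgtM
  have hh30d : (10 : ℝ) ^ 30 * (d : ℝ) ^ 2 ≤ h := by linarith
  have hh0 : 0 < h := by linarith
  -- "`h^{1/2} ≥ 10^15·d (≥ ξ_prm)`" (p. 213)
  have hs15d : (10 : ℝ) ^ 15 * d ≤ Real.sqrt h := by
    rw [← Real.sqrt_sq (show (0 : ℝ) ≤ 10 ^ 15 * d by positivity)]; exact Real.sqrt_le_sqrt (by nlinarith)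
  have hs15 : (10 : ℝ) ^ 15 ≤ Real.sqrt h := le_trans (by nlinarith) hs15d
  -- the curves without `F`-core are in the exceptional set (p. 212): `log(q^∀) ≤ 12` there
  have hcore : AdmitsCore P := by
    by_contra hno; have := logQForall_le_of_not_admitsCore hno; linarith
  -- `δ = 2^12·3^3·5·d`
  have hδeq : delta d = 552960 * d := delta_eq d
  have hδ : (552960 : ℝ) ≤ delta d := by rw [hδeq]; nlinarith
  have hδ2 : (2 : ℝ) ≤ delta d := by linarith
  have hdδ : (P.degree : ℝ) ≤ delta d := by
    have : (P.degree : ℝ) ≤ d := (by exact_mod_cast hPdeg); rw [hδeq]; nlinarith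
  -- the prime `l` of (P1), (P2), (P3) (p. 213–214), with `ξ_prm := 10^15` (Prop. 2.2 (ii), Dusart's fact)
  have hξ : IsXiPrm ((10 : ℝ) ^ 15) := isXiPrm_of_theta00071 (by norm_num) (fun x hx => prop22ii hD hx)
  have hprime : ∃ l : ℕ, l.Prime ∧ Real.sqrt h ≤ l ∧
      (l : ℝ) ≤ 1.464 * delta d * Real.sqrt h * Real.log (1.45 * delta d * h) ∧
      (∀ v ∈ badPlaces P, (-(ord P.F v (jInv P.x))).toNat ≠ 0 → ¬ l ∣ (-(ord P.F v (jInv P.x))).toNat) ∧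
      (∀ v ∈ badPlaces P, residueChar P.F v = l →
        (((-(ord P.F v (jInv P.x))).toNat : ℕ) : ℝ) < Real.sqrt h) :=
    Cor22.PrimeChoiceData.exists_prime_P1_P2_P3_expEst_of_dusart hD
      { ι := HeightOneSpectrum (𝓞 P.F), instDecEq := inferInstance, V := badPlaces P,
        hv := fun v => (-(ord P.F v (jInv P.x))).toNat, fv := resDeg P.F,
        one_le_fv := fun v _ => Nat.one_le_iff_ne_zero.mpr (resDeg_ne_zero P.F v),
        pv := residueChar P.F, pv_prime := fun v _ => residueChar_prime P.F v,
        d := P.degree, one_le_d := P.degree_pos, δ := delta d, two_le_δ := hδ2, d_le_δ := hdδ,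
        h := h, h_def := degree_mul_logQForall_eq_sum P, ξ := (10 : ℝ) ^ 15, isXiPrm := hξ,
        ξ_le_sqrt := hs15 }
      le_rfl hδ hs15
  obtain ⟨l, hlp, hP1lo, hP1hi, hP2, hP3⟩ := hprime
  haveI : Fact l.Prime := ⟨hlp⟩
  have hl15r : (10 : ℝ) ^ 15 ≤ (l : ℝ) := le_trans hs15 hP1lo
  have hl15 : 10 ^ 15 ≤ l := by exact_mod_cast hl15r
  have hl0 : (0 : ℝ) < l := by exact_mod_cast hlp.pos
  have hP2' : CondP2 P l := condP2_of_toNat hP2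
  -- (P3) ⟹ "`h − log(𝔮) ≤ h^{1/2}·log(l)`" with `log(𝔮) = log(q^{∤l})` (p. 216)
  have hQ1 : h - logQAvoid P {l} ≤ Real.sqrt h * Real.log l := by
    have := logQAvoid_sub_insert_le P ∅ hlp (Real.sqrt_nonneg h) (fun v hv hlv =>
      (hP3 v hv ((mem_placesOver_iff_residueChar v).mp (mem_placesOver_of_natCast_mem l v hlv))).le)
    rwa [Finset.insert_empty] at this
  -- (P5) (p. 215): otherwise `log(𝔮) = 0` and `h ≤ h^{1/2}·log(l) < h`
  have hP5 : CondP5Mu6 P l := by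
    by_contra hno
    have hq0 := logQAvoid_singleton_eq_zero_of_not_condP5Mu6 hno
    have hlt := condP5_numerics hd1 hh30d hl0 hP1hi
    rw [hq0] at hQ1
    linarith
  -- (P4) ⟹ (P6) (p. 215–216), the `𝒦`-half: Cor. 1.14 (ii)
  have hP6 : CondP6 P l := condP6_of_memKArc h110 hκ0 hκ1 hK hlp hl15 hP2' hP5 hgtκ
  -- (P7) + Theorem 5.1 (p. 216): the HYPOTHESIS
  have hdisp : Display51Mu6 P l := h51 P hPU l hlp hl15 hcore hP2' hP5 hP6
  -- (P8), Claims 5.2A/5.2B, (C2) (pp. 216–218), with `d*_mod` in the rôle of `e*_mod`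
  have hD0 : 0 ≤ P.logDiff + logCondAvoid P {l} :=
    add_nonneg P.logDiff_nonneg (logCondAvoid_nonneg P _)
  have hdm0 : (0 : ℝ) ≤ (dmod P : ℝ) := Nat.cast_nonneg _
  have h51' : 1 / 6 * logQAvoid P {l} ≤
      (1 + 20 * (dmod P : ℝ) / l) * (P.logDiff + logCondAvoid P {l})
        + 4.0881 * (2 ^ 12 * 3 ^ 3 * 5 * (dmod P : ℝ)) * l := by
    have e : 4.0881 * (2 ^ 12 * 3 ^ 3 * 5 * (dmod P : ℝ)) * l =
        4.0881 * (2 ^ 12 * 3 ^ 3 * 5 * (dmod P : ℝ) * l) := by ring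
    rw [e]; exact hdisp
  have hP3' : 1 / 6 * h - 1 / 6 * logQAvoid P {l} ≤ 1 / 6 * Real.sqrt h * Real.log l := by linarith
  have hC2' : 1 / 6 * h ≤ (1 + ε) * (P.logDiff + logCondAvoid P {l}) :=
    conditionC2_of_display hd1 hε0 hε1 hgt.le hP1lo hP1hi hD0 hdm0 (by nlinarith) (dstar_le_delta P hPdeg)
      h51' hP3'
  have hC2 : ConditionC2 ε P := by
    have hcond : P.logDiff + logCondAvoid P {l} ≤ P.logDiff + P.logCond := by
      linarith [logCondAvoid_le_logCond P hU {l}]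
    exact hC2'.trans (mul_le_mul_of_nonneg_left hcond (by linarith))
  exact ⟨l, hlp, ⟨hs15d, hP1lo, hP1hi⟩, hC2⟩

/-! ## 4. Corollary 5.2 as a whole, from the three named inputs -/

/-- **[ExpEst] Corollary 5.2 (both versions) from the three named inputs**: for `0 < κ ≤ 1`, `d ≥ 1`, `0 < ε ≤ 1`
(the printed ranges, p. 211 = p37.l5–12), `PartKappa κ d ε ∧ PartMcx d ε` — the closed sentence "Corollary 5.2"
as described (deliberately not declared as a `def`) in `ExplicitEstimatesCorollary52.lean`. Conditional on
`Thm51LegendreMu6` (DISPUTED claim), `Prop110`, Dusart's fact; nothing about abc is asserted.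
[claim: MochizukiEtAl2022, status: disputed] -/
theorem corollary52_of_thm51LegendreMu6 (h51 : Thm51LegendreMu6) (h110 : Prop110)
    (hD : Dusart2010_theta_thm_5_2) {κ : ℝ} (hκ0 : 0 < κ) (hκ1 : κ ≤ 1) {d : ℕ} (hd1 : 1 ≤ d) {ε : ℝ}
    (hε0 : 0 < ε) (hε1 : ε ≤ 1) : PartKappa κ d ε ∧ PartMcx d ε :=
  ⟨partKappa_of_thm51LegendreMu6 h51 h110 hD hκ0 hκ1 hd1 hε0 hε1,
    partMcx_of_thm51LegendreMu6 h51 h110 hD hd1 hε0 hε1⟩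

end ExpEst
end Literature.IUT.LogVolume

end
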